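import Summits.CriticalPhenomena.PercolationContinuityZ3.Theorems.PercMinContactLogMomentConverseTransport
import Summits.CriticalPhenomena.PercolationContinuityZ3.Theorems.PercMinContactLogMomentConverseCoupling
import Summits.CriticalPhenomena.PercolationContinuityZ3.Theorems.PercMinContactLogMomentConverseDoubling
import Literature.Barriers.CriticalPhenomena.SubexponentialGrowthZdCoupling

/-!
# Route `PercMinContact`, item `LogMomentConverse` (stmt-CriticalPhenomena-11501) — assembly

**Sharpness modulo a log-moment** (card C3 of the route): for bond percolation on `ℤ³`, if
`θ(p_c) = 0` and `E_{p_c}[log(1 + |C(0)|)] < ∞` then the min-contact function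
`m(u) = E_u[Σ_{y ∼ 0} 1{0 ↮ y} min(|C(0)|, |C(y)|)]` is integrable on `(0, p_c)`:
`∫_{(0,p_c)} m(u) du < ∞` — `theorem logMomentConverse_proof : LogMomentConverse`.

Proof (the item's paper proof, in the monotone coupling `Λ = labelMeasure`, `η_t(U) = configOfLabels t U`):
1. (part 1, `lintegral_minContact_le_tsum`) kernel bound + reflection + mass transport:
   `m(u) ≤ 2 Σ'_b Σ_{y ∼ b} P_u(A_{b,y})`, `A_{b,y} = {b ∈ C(0), y ∉ C(0), |C(0)| ≤ |C(y)|}`, and on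
   `A_{b,y}` the edge `e = s(b,y)` is closed, so `P_u(A_{b,y}) ≤ P_u{ω | ω \ {e} ∈ A_{b,y}} =
   Λ{U | η_u(U) \ {e} ∈ A_{b,y}}` (`level_integrand_le`);
2. (part 2, `setLIntegral_level_le_labelMeasure`) resampling the label of `e` and Tonelli:
   `∫_{(0,p_c)} Λ{η_u(U) \ {e} ∈ A_{b,y}} du ≤ Λ(S_{b,y})`, `S_{b,y} = {U e < p_c, η_{U e}(U) \ {e} ∈ A_{b,y}}`
   ("`(b, y)` is a swallow pair of `U`"), whence `∫_{(0,p_c)} m ≤ 2 E_Λ[N_sw]`, `N_sw(U) = #` swallow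
   pairs (`setLIntegral_le_two_mul_swallowCount`);
3. (part 3, `encard_swallowPairs_le_log`) pathwise, for injective labels (a.s.,
   `ae_injective_labelMeasure`) and `C_{p_c}(0)` finite (a.s., from `θ(p_c) = 0` transported by
   `map_configOfLabels_holds`), `N_sw ≤ log(|C_{p_c}(0)| + 1)/log 2` (each swallow doubles `|C(0)|`);
4. `E_Λ[log(|C_{p_c}(0)| + 1)] = E_{p_c}[log(|C(0)| + 1)] < ∞` by the coupling, so
   `∫_{(0,p_c)} m ≤ (2 / log 2) E_{p_c}[log(1 + |C(0)|)] < ∞`.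

References: the route's card C3; Grimmett 1999 §1.3 (coupling), §5.3 (Aizenman–Barsky / Lemma 5.51,
the factorised ancestor); Lyons–Peres 2016 §8.1 (mass transport).
-/

noncomputable section

namespace Summit.CriticalPhenomena.PercolationContinuityZ3.Theorems

namespace PercMinContactLMC

open MeasureTheory Literature.Probability.Percolation Literature.Probability.LatticeModels
open scoped ENNReal

variable {d : ℕ}

/-- **Steps 1–2 at a fixed level**: for `0 < u < p_c ≤ 1`,
`m(u) ≤ 2 Σ'_b Σ_{y ∼ b} Λ{U | η_u(U) \ {s(b,y)} ∈ A_{b,y}}`. [folklore] -/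
theorem level_integrand_le {pc : ℝ} (hpc : pc ≤ 1) {u : ℝ} (hu : u ∈ Set.Ioo 0 pc) :
    (∫⁻ ω, ∑ y ∈ (zdGraph d).neighborFinset (0 : Site d), (openConn (0 : Site d) y)ᶜ.indicator
        (fun ω => min ((openCluster ω 0).encard : ℝ≥0∞) ((openCluster ω y).encard : ℝ≥0∞)) ω
        ∂(bondPercolation (zdGraph d) (Set.projIcc (0 : ℝ) 1 zero_le_one u))) ≤
      2 * ∑' b, ∑ y ∈ (zdGraph d).neighborFinset b, labelMeasure (Site d)
        ((fun U : Sym2 (Site d) → ℝ => configOfLabels u U (zdGraph d) \ {s(b, y)}) ⁻¹'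
          {ω : BondConfig (Site d) | b ∈ openCluster ω 0 ∧ y ∉ openCluster ω 0 ∧
            ((openCluster ω 0).encard : ℝ≥0∞) ≤ (openCluster ω y).encard}) := by
  have hproj : ((Set.projIcc (0 : ℝ) 1 zero_le_one u : unitInterval) : ℝ) = u := by
    rw [Set.projIcc_of_mem zero_le_one ⟨hu.1.le, hu.2.le.trans hpc⟩]
  refine (lintegral_minContact_le_tsum _).trans ?_
  gcongr with b y
  calc bondPercolation (zdGraph d) (Set.projIcc (0 : ℝ) 1 zero_le_one u)
        {ω : BondConfig (Site d) | b ∈ openCluster ω 0 ∧ y ∉ openCluster ω 0 ∧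
          ((openCluster ω 0).encard : ℝ≥0∞) ≤ (openCluster ω y).encard}
      ≤ bondPercolation (zdGraph d) (Set.projIcc (0 : ℝ) 1 zero_le_one u)
          ((fun ω : BondConfig (Site d) => ω \ {s(b, y)}) ⁻¹'
            {ω : BondConfig (Site d) | b ∈ openCluster ω 0 ∧ y ∉ openCluster ω 0 ∧
              ((openCluster ω 0).encard : ℝ≥0∞) ≤ (openCluster ω y).encard}) :=
        measure_mono (swallowEvt_subset_preimage_diff b y)
    _ = labelMeasure (Site d) ((fun U : Sym2 (Site d) → ℝ =>
          configOfLabels ((Set.projIcc (0 : ℝ) 1 zero_le_one u : unitInterval) : ℝ) U (zdGraph d) \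
            {s(b, y)}) ⁻¹'
          {ω : BondConfig (Site d) | b ∈ openCluster ω 0 ∧ y ∉ openCluster ω 0 ∧
            ((openCluster ω 0).encard : ℝ≥0∞) ≤ (openCluster ω y).encard}) :=
        bondPercolation_preimage_diff_eq (zdGraph d) _ _ (measurableSet_swallowEvt b y)
    _ = _ := by rw [hproj]

/-- **Steps 1–2 integrated over the level**: for `p_c ≤ 1`,
`∫_{(0,p_c)} m(u) du ≤ 2 E_Λ[N_sw]`, `N_sw(U) = Σ'_b Σ_{y ∼ b} 1{(b,y) swallow pair of U}`. [folklore] -/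
theorem setLIntegral_le_two_mul_swallowCount {pc : ℝ} (hpc : pc ≤ 1) :
    ∫⁻ u in Set.Ioo 0 pc, (∫⁻ ω, ∑ y ∈ (zdGraph d).neighborFinset (0 : Site d),
        (openConn (0 : Site d) y)ᶜ.indicator
        (fun ω => min ((openCluster ω 0).encard : ℝ≥0∞) ((openCluster ω y).encard : ℝ≥0∞)) ω
        ∂(bondPercolation (zdGraph d) (Set.projIcc (0 : ℝ) 1 zero_le_one u))) ≤
      2 * ∫⁻ U, ∑' b, ∑ y ∈ (zdGraph d).neighborFinset b,
        {U : Sym2 (Site d) → ℝ | U s(b, y) < pc ∧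
          configOfLabels (U s(b, y)) U (zdGraph d) \ {s(b, y)} ∈
            {ω : BondConfig (Site d) | b ∈ openCluster ω 0 ∧ y ∉ openCluster ω 0 ∧
              ((openCluster ω 0).encard : ℝ≥0∞) ≤ (openCluster ω y).encard}}.indicator
          (fun _ => (1 : ℝ≥0∞)) U ∂(labelMeasure (Site d)) := by
  classical
  have hΛ : IsProbabilityMeasure (labelMeasure (Site d)) := isProbabilityMeasure_labelMeasure _
  -- the swallow-candidate events `A b y`, the level events and the swallow events `S b y`
  have hAm : ∀ b y : Site d, MeasurableSet {ω : BondConfig (Site d) | b ∈ openCluster ω 0 ∧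
      y ∉ openCluster ω 0 ∧ ((openCluster ω 0).encard : ℝ≥0∞) ≤ (openCluster ω y).encard} :=
    fun b y => measurableSet_swallowEvt b y
  have hLm : ∀ b y : Site d, Measurable fun t : ℝ => labelMeasure (Site d)
      ((fun U : Sym2 (Site d) → ℝ => configOfLabels t U (zdGraph d) \ {s(b, y)}) ⁻¹'
        {ω : BondConfig (Site d) | b ∈ openCluster ω 0 ∧ y ∉ openCluster ω 0 ∧
          ((openCluster ω 0).encard : ℝ≥0∞) ≤ (openCluster ω y).encard}) :=
    fun b y => measurable_labelMeasure_level (zdGraph d) s(b, y) (hAm b y)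
  have hSm : ∀ b y : Site d, MeasurableSet {U : Sym2 (Site d) → ℝ | U s(b, y) < pc ∧
      configOfLabels (U s(b, y)) U (zdGraph d) \ {s(b, y)} ∈
        {ω : BondConfig (Site d) | b ∈ openCluster ω 0 ∧ y ∉ openCluster ω 0 ∧
          ((openCluster ω 0).encard : ℝ≥0∞) ≤ (openCluster ω y).encard}} :=
    fun b y => (measurableSet_lt (measurable_pi_apply _) measurable_const).inter
      ((hAm b y).preimage (measurable_configOfLabels_diff_self (zdGraph d) s(b, y)))
  -- step 1 integrated
  refine (setLIntegral_mono' measurableSet_Ioo fun u hu => level_integrand_le hpc hu).trans ?_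
  rw [lintegral_const_mul' _ _ ENNReal.ofNat_ne_top]
  gcongr
  rw [lintegral_tsum fun b => (Finset.measurable_sum _ fun y _ => hLm b y).aemeasurable,
    lintegral_tsum fun b => (Finset.measurable_sum _ fun y _ =>
      measurable_const.indicator (hSm b y)).aemeasurable]
  refine ENNReal.tsum_le_tsum fun b => ?_
  rw [lintegral_finsetSum _ fun y _ => hLm b y,
    lintegral_finsetSum _ fun y _ => measurable_const.indicator (hSm b y)]
  refine Finset.sum_le_sum fun y _ => ?_
  rw [lintegral_indicator_const (hSm b y), one_mul]
  -- step 2: resampling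
  exact setLIntegral_level_le_labelMeasure (zdGraph d) s(b, y) (hAm b y) hpc

/-- **Step 3 almost surely**: if `θ(p) = 0` at the level `p`, then for `Λ`-a.e. label field `U` the
swallow count is at most `log(|C_p(0)| + 1) / log 2` (labels are a.s. injective, `C_p(0)` is a.s.
finite, and each swallow doubles the cluster of the origin). [folklore] -/
theorem ae_swallowCount_le_log (p : unitInterval) (htheta : theta (zdGraph d) (0 : Site d) p = 0) :
    ∀ᵐ U ∂(labelMeasure (Site d)), ∑' b, ∑ y ∈ (zdGraph d).neighborFinset b,
        {U : Sym2 (Site d) → ℝ | U s(b, y) < (p : ℝ) ∧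
          configOfLabels (U s(b, y)) U (zdGraph d) \ {s(b, y)} ∈
            {ω : BondConfig (Site d) | b ∈ openCluster ω 0 ∧ y ∉ openCluster ω 0 ∧
              ((openCluster ω 0).encard : ℝ≥0∞) ≤ (openCluster ω y).encard}}.indicator
          (fun _ => (1 : ℝ≥0∞)) U ≤
      ENNReal.ofReal (Real.log ((openCluster (configOfLabels (p : ℝ) U (zdGraph d)) 0).ncard + 1) /
        Real.log 2) := by
  classical
  -- `C_p(0)` is a.s. finite in the coupling
  have h0 : bondPercolation (zdGraph d) p (percolatesAt (0 : Site d)) = 0 :=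
    (measureReal_eq_zero_iff (measure_ne_top _ _)).1 htheta
  have h0' : labelMeasure (Site d)
      ((fun U : Sym2 (Site d) → ℝ => configOfLabels (p : ℝ) U (zdGraph d)) ⁻¹' percolatesAt 0) = 0 := by
    rw [← Measure.map_apply (measurable_configOfLabels _ _) (measurableSet_percolatesAt_holds 0),
      map_configOfLabels_holds (zdGraph d) p]
    exact h0
  have hfin : ∀ᵐ U ∂(labelMeasure (Site d)), (openCluster (configOfLabels (p : ℝ) U (zdGraph d)) 0).Finite := by
    filter_upwards [measure_eq_zero_iff_ae_notMem.1 h0'] with U hU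
    exact Set.not_infinite.1 hU
  filter_upwards [Literature.Barriers.CriticalPhenomena.ae_injective_labelMeasure (V := Site d), hfin]
    with U hU hUfin
  exact (tsum_sum_indicator_swallow_eq_encard (zdGraph d) 0 (p : ℝ) U).trans_le
    (encard_swallowPairs_le_log (zdGraph d) 0 (p : ℝ) U hU hUfin)

/-- **Step 4, change of variables**: `E_Λ[log(|C_p(0)| + 1)] = E_p[log(|C(0)| + 1)]`. [folklore] -/
theorem lintegral_log_ncard_coupling (p : unitInterval) :
    ∫⁻ U, ENNReal.ofReal (Real.log ((openCluster (configOfLabels (p : ℝ) U (zdGraph d)) (0 : Site d)).ncard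
        + 1)) ∂(labelMeasure (Site d)) =
      ∫⁻ ω, ENNReal.ofReal (Real.log ((openCluster ω (0 : Site d)).ncard + 1))
        ∂(bondPercolation (zdGraph d) p) := by
  have hf : Measurable fun ω : BondConfig (Site d) =>
      ENNReal.ofReal (Real.log ((openCluster ω (0 : Site d)).ncard + 1)) :=
    (measurable_from_nat (f := fun n : ℕ => ENNReal.ofReal (Real.log ((n : ℝ) + 1)))).comp
      (measurable_ncard.comp (measurable_openCluster (0 : Site d)))
  rw [← map_configOfLabels_holds (zdGraph d) p, lintegral_map hf (measurable_configOfLabels _ _)]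

end PercMinContactLMC

open MeasureTheory Literature.Probability.Percolation Literature.Probability.LatticeModels
  PercMinContactLMC in
/-- **Item `stmt-CriticalPhenomena-11501` (`PercMinContact.LogMomentConverse`), proved** — sharpness
modulo a log-moment: on `ℤ³`, `θ(p_c) = 0` and `E_{p_c}[log(1 + |C(0)|)] < ∞` imply
`∫_{(0,p_c)} m(u) du < ∞` for the min-contact function `m(u) = E_u[Σ_{y ∼ 0} 1{0 ↮ y} min(|C(0)|,|C(y)|)]`.
Swallow-count argument in the monotone coupling: `∫ m ≤ 2 E N_sw ≤ (2/log 2) E log(1 + |C_{p_c}(0)|)`.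
[folklore] -/
theorem logMomentConverse_proof :
    Summit.CriticalPhenomena.PercolationContinuityZ3.Theses.PercMinContact.LogMomentConverse := by
  unfold Summit.CriticalPhenomena.PercolationContinuityZ3.Theses.PercMinContact.LogMomentConverse
  intro htheta hlog
  have hpc1 : criticalProb (zdGraph 3) (0 : Site 3) ≤ 1 := (criticalProb_mem_Icc _ _).2
  have hc : ENNReal.ofReal (Real.log 2) ≠ 0 :=
    (ENNReal.ofReal_pos.2 (Real.log_pos one_lt_two)).ne'
  refine ((setLIntegral_le_two_mul_swallowCount (d := 3) hpc1).trans
    (mul_le_mul_right (lintegral_mono_ae (ae_swallowCount_le_log (criticalProbI 3) htheta)) 2)).trans_lt ?_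
  simp_rw [ENNReal.ofReal_div_of_pos (Real.log_pos one_lt_two), ENNReal.div_eq_inv_mul]
  rw [lintegral_const_mul' _ _ (ENNReal.inv_ne_top.2 hc), lintegral_log_ncard_coupling]
  exact ENNReal.mul_lt_top ENNReal.ofNat_lt_top
    (ENNReal.mul_lt_top (ENNReal.inv_lt_top.2 (pos_iff_ne_zero.2 hc)) hlog)

end Summit.CriticalPhenomena.PercolationContinuityZ3.Theorems

end
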